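import Mathlib
import Literature.Algebra.Polynomial.HandelmanHypercubeQuadratic
import Literature.Algebra.Polynomial.PolyaSimplexRate
import Literature.Combinatorics.Enumerative.StirlingSecondFallingFactorials
import HarnessLib

/-!
# Explicit degree bounds for Handelman certificates of ANY polynomial positive on the hypercube
# (de Klerk–Laurent 2010, §3: Lemma 3.1, (3.1)–(3.6), Proposition 3.3, Theorem 3.4 = Theorem 1.4)

Topic `Literature/Algebra/Polynomial`, namespace `Literature.Algebra.Polynomial.HandelmanHypercubeDegree`.
Continues `HandelmanHypercubeQuadratic.lean` (the cone `H_r(g)` = `IsHandelmanCube r`, the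
Bernstein operator `bernsteinOp d`, Theorem 2.1 for quadratics) to polynomials of arbitrary degree,
reusing its vocabulary BY NAME, `PolyaSimplexRate.lean` for the elementary bound
`d(d−1)⋯(d−k+1)/dᵏ ≥ 1 − C(k,2)/d` (`one_sub_choose_div_le_polyaWeight`), and the tree's
`Combinatorics/Enumerative/StirlingSecondFallingFactorials.lean` for the expansion of powers in
falling factorials `mⁿ = Σ_k S₂(n,k) m^{(k)}` (`pow_eq_sum_stirlingSecond_descFactorial`, with
Mathlib's `Nat.stirlingSecond`).

## Source, read on the page

E. de Klerk, M. Laurent, *Error bounds for some semidefinite programming approaches to polynomial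
minimization on the hypercube*, SIAM J. Optim. 20(6) (2010) 3104–3120 [held text
`paper:doi-10-1137-100790835`, p0011–p0014].  With `Q = [0,1]ⁿ`, `g = (x₁,…,xₙ,1−x₁,…,1−xₙ)`
(1.5), `H_r(g) = {Σ λ_k g^k : deg(λ_k g^k) ≤ r, λ_k ≥ 0}` (1.9), `L(p) = max_k |p_k| k!/|k|!`
(1.3), and the Bernstein operator `B_d` (1.16)–(1.18):
* **Lemma 3.1.** «For any `h, k ∈ ℕⁿ`, `−x^h(1−x)^k + 1 ∈ H_t(g)`, where `t := |h + k|`.»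
* **(3.1)** «our strategy is now to write `p` as `p = B_d(p − p_min) + q + p_min,Q − C(d,p)`, where
  `q ∈ H_t(g)` … and `C(d,p)` is a constant which depends only on `p` and `d`.»
* §3.1 (univariate): «`B_d(xᵏ) = Σᵢ₌₀ᵏ (1/dᵏ) b_{k,i} d^{(i)} xⁱ` … where
  `d^{(i)} = d(d−1)⋯(d−i+1)`, `b_{k,i} > 0` and `b_{k,k} = 1`. Moreover
  `(1/dᵏ) Σᵢ b_{k,i} d^{(i)} = 1` (3.2)»; **Lemma 3.2 (ii)** «`B_d(xᵏ) = xᵏ + Σᵢ₌₀ᵏ aᵢ^{(k)} xⁱ`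
  for some scalars `aᵢ^{(k)}` satisfying `−(1/d) C(k,2) ≤ a_k^{(k)} ≤ 0`, `0 ≤ aᵢ^{(k)}` for
  `i ≤ k−1`, and `Σᵢ₌₀^{k−1} aᵢ^{(k)} ≤ (1/d) C(k,2)`»; **Proposition 3.3** (univariate,
  `C(d,p) ≤ (L(p)/d) C(m+1,3)`).
* §3.2 (multivariate), (3.5)–(3.6): «`C(d,p) ≤ (L(p)/d) Σ_{|k|≤m} (|k|!/k!) Σⱼ C(kⱼ,2)`», then
  «`≤ (L(p)/d) C(m+1,3) nᵐ`» (3.6).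
* **Theorem 3.4** (= Theorem 1.4 (i),(ii)). «Let `p` be a polynomial of degree `m`, `Q = [0,1]ⁿ`,
  and `g` as in (1.5). (i) For any integer `d ≥ 1`, `p − p_min,Q + (L(p)/d) C(m+1,3) nᵐ ∈ H_r(g)`
  for some integer `r ≤ max(dn, m)`. (ii) If `p` is positive on `Q`, then `p ∈ H_r(g)` for some
  integer `r ≤ n ⌈(L(p)/p_min,Q) C(m+1,3) nᵐ⌉`.»

## What is formalised (all proved, no named facts)

Over a linearly ordered field `𝕜`, variables indexed by a finite type `ι` (`n = |ι|`):
* §1 ★ `isHandelmanCube_one_sub_cubeProd` — Lemma 3.1 as printed.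
* §2 (the `b_{k,i}` of §3.1 are the Stirling numbers of the second kind `Nat.stirlingSecond k i`,
  through the tree's `pow_eq_sum_stirlingSecond_descFactorial`) the factorial moments of the
  Bernstein basis `Σ_m m^{(i)} p_{d,m}(x) = d^{(i)} xⁱ`
  (`sum_descFactorial_mul_bern`), whence `B_d(xᵏ) = Σᵢ a_{k,i} xⁱ` with
  `a_{k,i} = S(k,i) d^{(i)}/dᵏ ≥ 0`, `Σᵢ a_{k,i} = 1`, `a_{k,k} = d^{(k)}/dᵏ ≥ 1 − C(k,2)/d`
  (`bernCoeff`, `sum_pow_div_mul_bern`, Lemma 3.2 (ii) in the form used).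
* §3 the multivariate monomial: `B_d(x^α) = Σ_{γ ≤ α} A_γ x^γ` with `A ≥ 0`, `Σ A = 1`,
  `A_α = ∏ᵢ d^{(αᵢ)}/d^{αᵢ}` (`bernsteinOp_monomial`), and the per-monomial defect
  `δ_α = 1 − A_α ≤ (1/d) Σᵢ C(αᵢ,2)` (`monomialDefect_le`).
* §4 ★ the sign-split (3.5): `p_α (x^α − B_d(x^α)) + |p_α| δ_α ∈ H_{|α|}(g)`
  (`isHandelmanCube_coeff_mul_sub_bernsteinOp`), hence
  `p − B_d(p) + C(d,p) ∈ H_m(g)` with the EXACT constant `C(d,p) = Σ_α |p_α| δ_α`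
  (`dklConstant`, `isHandelmanCube_sub_bernsteinOp`) and the bound
  `C(d,p) ≤ (1/d) Σ_α |p_α| Σᵢ C(αᵢ,2)` (`dklConstant_le`, the first inequality of (3.5)–(3.6)).
* §5 ★★ **Theorem 3.4 (i)** with the sharper explicit constant: for every `d ≥ 1`, every `μ` with
  `μ ≤ p` on the GRID `Q(d)` and every `c ≥ C(d,p)`, `p − μ + c ∈ H_{max(dn,m)}(g)`
  (`isHandelmanCube_sub_C_add_C`); ★★ **Theorem 3.4 (ii)**: if `μ ≤ p` on `Q(d)` and
  `C(d,p) ≤ μ` — in particular if `(1/d) Σ_α |p_α| Σᵢ C(αᵢ,2) ≤ μ` — then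
  `p ∈ H_{max(dn,m)}(g)` (`isHandelmanCube_of_dklConstant_le`, `isHandelmanCube_of_le`); and the
  grid error bound `p_min,Q ≥ p_min,Q(d) − C(d,p)` for every degree (`le_eval_of_grid`), the
  analogue of Theorem 1.4 (iii).

* §6 the counting of (3.6): `Σⱼ C(kⱼ,2) ≤ C(|k|,2)` (`sum_choose_two_le`), `Σ_{|k|=l} |k|!/k! ≤ nˡ`
  (`sum_multinomial_le_pow`), `Σ_{l≤m} C(l,2) = C(m+1,3)` (`sum_range_choose_two`), hence
  `C(d,p) ≤ (L/d) C(m+1,3) nᵐ` whenever `|p_k| ≤ L |k|!/k!` (`dklConstant_le_printed`), and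
  ★★ **Theorem 3.4 (i)/(ii) AS PRINTED** (`isHandelmanCube_sub_C_add_C_printed`,
  `isHandelmanCube_of_printed`), with `L(p)` entering as any `L` with `|p_k| ≤ L·|k|!/k!`.

## Declared deviations

The constant `C(d,p)` is given in the closed form `Σ_α |p_α| δ_α`, `δ_α = 1 − ∏ᵢ d^{(αᵢ)}/d^{αᵢ}`,
and bounded by `(1/d) Σ_α |p_α| Σᵢ C(αᵢ,2)` and then by the printed `(L(p)/d) C(m+1,3) nᵐ`; the
telescoping (3.5) over `j` is replaced by the direct expansion of `∏ᵢ B_d(xᵢ^{αᵢ})`, which gives the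
same per-monomial bound `Σᵢ C(αᵢ,2)/d`.  In (ii) the degree is `max(dn, m)` as in (i) and in
Proposition 3.3 (the printed `r ≤ n⌈…⌉` omits the `max` with `m`: for `n = 1`,
`p = 1 + x − x²/2` has `L(p) = p_min = 1`, so the printed bound would give `p ∈ H_1(g)`, which is
impossible for a polynomial of degree 2; (3.4) gives `p ∈ H_2(g)`).  The lower bound `μ` is only
required on the grid `Q(d)`, as in the proof ((3.1) uses `B_d(p − p_min) ∈ H_{dn}` through the
values `p(k/d) − p_min ≥ 0`).
-/

noncomputable section

open MvPolynomial Finset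

open scoped BigOperators

namespace Literature.Algebra.Polynomial.HandelmanHypercubeDegree

open Literature.Algebra.Polynomial.HandelmanHypercubeQuadratic
open Literature.Algebra.Polynomial.PolyaSimplexRate (polyaWeight polyaWeight_pos polyaWeight_le_one
  one_sub_choose_div_le_polyaWeight)
open Literature.Combinatorics.Enumerative.StirlingSecondFallingFactorials
  (pow_eq_sum_stirlingSecond_descFactorial)

variable {𝕜 : Type*} [Field 𝕜] [LinearOrder 𝕜] [IsStrictOrderedRing 𝕜]
variable {ι : Type*} [Fintype ι]

/-! ### §1 Lemma 3.1: `1 − x^h (1 − x)^k ∈ H_{|h+k|}(g)` -/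

omit [LinearOrder 𝕜] [IsStrictOrderedRing 𝕜] in
/-- `g^{β+γ} = g^β g^γ`. [cite: DeklerkLaurent2010, §1.1 eq. (1.9)] -/
theorem cubeProd_add (β γ : ι ⊕ ι →₀ ℕ) :
    (cubeProd (β + γ) : MvPolynomial ι 𝕜) = cubeProd β * cubeProd γ := by
  unfold cubeProd
  simp only [Finsupp.add_apply, pow_add, Finset.prod_mul_distrib]
  ring

omit [LinearOrder 𝕜] [IsStrictOrderedRing 𝕜] in
/-- The generator `g_a`: `g^{e_a}` is `xᵢ` for `a = inl i` and `1 − xᵢ` for `a = inr i`.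
[cite: DeklerkLaurent2010, §1.1 eq. (1.5)] -/
theorem cubeProd_single (a : ι ⊕ ι) :
    (cubeProd (Finsupp.single a 1) : MvPolynomial ι 𝕜) = Sum.elim (fun i => X i) (fun i => 1 - X i) a := by
  classical
  unfold cubeProd
  rcases a with i | i
  · rw [Finset.prod_eq_single i (fun j _ hj => by
        rw [Finsupp.single_apply, if_neg (fun h => hj (Sum.inl_injective h).symm), pow_zero])
        (fun h => absurd (Finset.mem_univ i) h),
      Finset.prod_eq_one (fun j _ => by rw [Finsupp.single_apply, if_neg Sum.inl_ne_inr, pow_zero])]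
    simp
  · rw [Finset.prod_eq_one (fun j _ => by rw [Finsupp.single_apply, if_neg Sum.inr_ne_inl, pow_zero]),
      Finset.prod_eq_single i (fun j _ hj => by
        rw [Finsupp.single_apply, if_neg (fun h => hj (Sum.inr_injective h).symm), pow_zero])
        (fun h => absurd (Finset.mem_univ i) h)]
    simp

/-- `g^β ∈ H_{|β|}(g)`. [cite: DeklerkLaurent2010, §1.1 eq. (1.9)] -/
theorem isHandelmanCube_cubeProd (β : ι ⊕ ι →₀ ℕ) :
    IsHandelmanCube β.degree (cubeProd β : MvPolynomial ι 𝕜) := by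
  have h := IsHandelmanCube.gen (𝕜 := 𝕜) β le_rfl zero_le_one
  rwa [map_one, one_mul] at h

/-- `1 − g_a ∈ H_1(g)` for every generator. [cite: DeklerkLaurent2010, §3 Lemma 3.1 (proof, n = 1)] -/
theorem isHandelmanCube_one_sub_cubeProd_single (a : ι ⊕ ι) :
    IsHandelmanCube 1 (1 - cubeProd (Finsupp.single a 1) : MvPolynomial ι 𝕜) := by
  rw [cubeProd_single]
  rcases a with i | i
  · exact isHandelmanCube_one_sub_X i
  · simp only [Sum.elim_inr, sub_sub_cancel]
    exact isHandelmanCube_X i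

/-- **Lemma 3.1.** «For any `h, k ∈ ℕⁿ`, `−x^h(1−x)^k + 1 ∈ H_t(g)`, where `t := |h + k|`.»
Proof as printed, one generator at a time: `1 − g_a M = (1 − M) + (1 − g_a) M`.
[cite: DeklerkLaurent2010, §3 Lemma 3.1] -/
theorem isHandelmanCube_one_sub_cubeProd (β : ι ⊕ ι →₀ ℕ) :
    IsHandelmanCube β.degree (1 - cubeProd β : MvPolynomial ι 𝕜) := by
  classical
  suffices h : ∀ (n : ℕ) (β : ι ⊕ ι →₀ ℕ), β.degree = n →
      IsHandelmanCube n (1 - cubeProd β : MvPolynomial ι 𝕜) from h _ β rfl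
  intro n
  induction n with
  | zero =>
    intro β hβ
    rw [(Finsupp.degree_eq_zero_iff β).1 hβ]
    simp only [cubeProd, Finsupp.coe_zero, Pi.zero_apply, pow_zero, Finset.prod_const_one,
      mul_one, sub_self]
    exact IsHandelmanCube.zero
  | succ n ih =>
    intro β hβ
    have hne : β ≠ 0 := by
      rintro rfl
      simp at hβ
    obtain ⟨a, ha⟩ := Finsupp.ne_iff.1 hne
    rw [Finsupp.coe_zero, Pi.zero_apply] at ha
    set β' := β - Finsupp.single a 1 with hβ'
    have hsplit : β = β' + Finsupp.single a 1 := (Finsupp.sub_add_single_one_cancel ha).symm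
    have hdeg' : β'.degree = n := by
      have h2 := congrArg Finsupp.degree hsplit
      rw [map_add, Finsupp.degree_single, hβ] at h2
      omega
    have e : (1 - cubeProd β : MvPolynomial ι 𝕜) =
        (1 - cubeProd β') + (1 - cubeProd (Finsupp.single a 1)) * cubeProd β' := by
      rw [hsplit, cubeProd_add]
      ring
    rw [e]
    have h1 := (ih β' hdeg').mono (Nat.le_succ n)
    have h2 := (isHandelmanCube_one_sub_cubeProd_single (𝕜 := 𝕜) a).mul
      (isHandelmanCube_cubeProd (𝕜 := 𝕜) β')
    rw [hdeg', add_comm] at h2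
    exact h1.add h2

/-! ### §2 The factorial moments of the Bernstein basis and `B_d(xᵏ)` in the monomial basis -/

variable [DecidableEq ι]

omit [LinearOrder 𝕜] [IsStrictOrderedRing 𝕜] [Fintype ι] [DecidableEq ι] in
/-- **Factorial moments of the Bernstein basis**: `Σ_m m^{(l)} p_{d,m}(xᵢ) = d^{(l)} xᵢˡ`
(`C(d,m) m^{(l)} = d^{(l)} C(d−l,m−l)` and the binomial theorem).
[cite: DeklerkLaurent2010, §1.3 eq. (1.18) / §3.1 (B_d of monomials)] -/
theorem sum_descFactorial_mul_bern (i : ι) (d l : ℕ) :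
    ∑ m ∈ Finset.range (d + 1), C ((m.descFactorial l : ℕ) : 𝕜) * (bern i d m : MvPolynomial ι 𝕜) =
      C ((d.descFactorial l : ℕ) : 𝕜) * X i ^ l := by
  rcases Nat.lt_or_ge d l with hdl | hld
  · -- every `m ≤ d < l` has `m^{(l)} = 0`, and `d^{(l)} = 0`
    rw [Nat.descFactorial_eq_zero_iff_lt.2 hdl, Nat.cast_zero, map_zero, zero_mul]
    refine Finset.sum_eq_zero fun m hm => ?_
    rw [Nat.descFactorial_eq_zero_iff_lt.2 ((Finset.mem_range_succ_iff.1 hm).trans_lt hdl),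
      Nat.cast_zero, map_zero, zero_mul]
  · rw [← Finset.sum_range_add_sum_Ico _ (Nat.le_succ_of_le hld)]
    have h0 : ∑ m ∈ Finset.range l, C ((m.descFactorial l : ℕ) : 𝕜) * (bern i d m : MvPolynomial ι 𝕜)
        = 0 := Finset.sum_eq_zero fun m hm => by
      rw [Nat.descFactorial_eq_zero_iff_lt.2 (Finset.mem_range.1 hm), Nat.cast_zero, map_zero,
        zero_mul]
    rw [h0, zero_add, Finset.sum_Ico_eq_sum_range]
    have hdl' : d + 1 - l = d - l + 1 := by omega
    rw [hdl']
    -- rewrite each term with `C(d, l+m') (l+m')^{(l)} = d^{(l)} C(d-l, m')`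
    have hterm : ∀ m' ∈ Finset.range (d - l + 1),
        C (((l + m').descFactorial l : ℕ) : 𝕜) * (bern i d (l + m') : MvPolynomial ι 𝕜) =
          C ((d.descFactorial l : ℕ) : 𝕜) * X i ^ l *
            (X i ^ m' * (1 - X i) ^ (d - l - m') * C (((d - l).choose m' : ℕ) : 𝕜)) := by
      intro m' hm'
      have hm'le : m' ≤ d - l := Nat.lt_succ_iff.1 (Finset.mem_range.1 hm')
      rw [bern_eq]
      have hnat : (l + m').descFactorial l * d.choose (l + m') =
          d.descFactorial l * (d - l).choose m' := by
        rw [Nat.descFactorial_eq_factorial_mul_choose, Nat.descFactorial_eq_factorial_mul_choose,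
          mul_assoc, mul_comm ((l + m').choose l), Nat.choose_mul (Nat.le_add_right l m'),
          Nat.add_sub_cancel_left, mul_assoc]
      have hpow : d - (l + m') = d - l - m' := by omega
      calc C (((l + m').descFactorial l : ℕ) : 𝕜) *
            (C ((d.choose (l + m') : ℕ) : 𝕜) * X i ^ (l + m') * (1 - X i) ^ (d - (l + m')))
          = C ((((l + m').descFactorial l * d.choose (l + m') : ℕ) : 𝕜)) *
              (X i ^ (l + m') * (1 - X i) ^ (d - (l + m'))) := by
            rw [Nat.cast_mul, map_mul]; ring
        _ = _ := by
            rw [hnat, Nat.cast_mul, map_mul, hpow, pow_add]; ring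
    rw [Finset.sum_congr rfl hterm, ← Finset.mul_sum]
    have hbin : ∑ m' ∈ Finset.range (d - l + 1),
        (X i : MvPolynomial ι 𝕜) ^ m' * (1 - X i) ^ (d - l - m') * C (((d - l).choose m' : ℕ) : 𝕜) = 1 := by
      have h := (add_pow (X i : MvPolynomial ι 𝕜) (1 - X i) (d - l)).symm
      simp only [map_natCast] 
      rw [h, add_sub_cancel, one_pow]
    rw [hbin, mul_one]

/-- **The coefficients `a_{k,i} = S(k,i) d^{(i)} / dᵏ` of `B_d(xᵏ)` in the monomial basis.**
[cite: DeklerkLaurent2010, §3.1 («B_d(xᵏ) = Σᵢ (1/dᵏ) b_{k,i} d^{(i)} xⁱ»)] -/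
def bernCoeff (d k i : ℕ) : 𝕜 := ((k.stirlingSecond i * d.descFactorial i : ℕ) : 𝕜) / (d : 𝕜) ^ k

omit [Fintype ι] [DecidableEq ι] in
/-- `a_{k,i} ≥ 0` («`b_{k,i} > 0`», hence `0 ≤ aᵢ^{(k)}` for `i ≤ k−1`).
[cite: DeklerkLaurent2010, §3.1 Lemma 3.2 (ii)] -/
theorem bernCoeff_nonneg (d k i : ℕ) : 0 ≤ (bernCoeff d k i : 𝕜) :=
  div_nonneg (Nat.cast_nonneg _) (pow_nonneg (Nat.cast_nonneg _) _)

omit [LinearOrder 𝕜] [IsStrictOrderedRing 𝕜] [Fintype ι] [DecidableEq ι] in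
/-- `a_{k,k} = d^{(k)}/dᵏ` («`b_{k,k} = 1`»). [cite: DeklerkLaurent2010, §3.1 Lemma 3.2 (ii)] -/
theorem bernCoeff_self (d k : ℕ) : (bernCoeff d k k : 𝕜) = ((d.descFactorial k : ℕ) : 𝕜) / (d : 𝕜) ^ k := by
  rw [bernCoeff, Nat.stirlingSecond_self, one_mul]

omit [LinearOrder 𝕜] [IsStrictOrderedRing 𝕜] [Fintype ι] [DecidableEq ι] in
/-- **`B_d(xᵢᵏ)` in the monomial basis**: `Σ_m (m/d)ᵏ p_{d,m}(xᵢ) = Σᵢ₌₀ᵏ a_{k,i} xᵢⁱ`.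
[cite: DeklerkLaurent2010, §3.1 («B_d(xᵏ) = Σᵢ (1/dᵏ) b_{k,i} d^{(i)} xⁱ»)] -/
theorem sum_pow_div_mul_bern [CharZero 𝕜] (i : ι) {d : ℕ} (hd : 0 < d) (k : ℕ) :
    ∑ m : Fin (d + 1), C ((((m : ℕ) : 𝕜) / d) ^ k) * (bern i d m : MvPolynomial ι 𝕜) =
      ∑ l ∈ Finset.range (k + 1), C (bernCoeff d k l : 𝕜) * X i ^ l := by
  have hdne : (d : 𝕜) ≠ 0 := by exact_mod_cast hd.ne'
  rw [Fin.sum_univ_eq_sum_range (fun m => C ((((m : ℕ) : 𝕜) / d) ^ k) *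
    (bern i d m : MvPolynomial ι 𝕜)) (d + 1)]
  have h1 : ∀ m : ℕ, C ((((m : ℕ) : 𝕜) / d) ^ k) * (bern i d m : MvPolynomial ι 𝕜) =
      C ((d : 𝕜) ^ k)⁻¹ * ∑ l ∈ Finset.range (k + 1),
        C ((k.stirlingSecond l : ℕ) : 𝕜) * (C ((m.descFactorial l : ℕ) : 𝕜) * bern i d m) := by
    intro m
    rw [div_pow, div_eq_inv_mul, map_mul, mul_assoc]
    congr 1
    rw [← Nat.cast_pow, pow_eq_sum_stirlingSecond_descFactorial m k, Nat.cast_sum, map_sum,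
      Finset.sum_mul]
    refine Finset.sum_congr rfl fun l _ => ?_
    rw [Nat.cast_mul, map_mul, mul_assoc]
  rw [Finset.sum_congr rfl fun m _ => h1 m, ← Finset.mul_sum, Finset.sum_comm]
  rw [Finset.sum_congr rfl fun l _ => by rw [← Finset.mul_sum, sum_descFactorial_mul_bern],
    Finset.mul_sum]
  refine Finset.sum_congr rfl fun l _ => ?_
  rw [bernCoeff, ← mul_assoc, ← mul_assoc, ← map_mul, ← map_mul, Nat.cast_mul]
  congr 2
  rw [div_eq_inv_mul, mul_assoc]

omit [Fintype ι] [DecidableEq ι] in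
/-- **(3.2)**: `Σᵢ₌₀ᵏ a_{k,i} = 1` («which follows from the fact that `B_d(f)(1) = f(1) = 1` for
`f(x) = xᵏ`»). [cite: DeklerkLaurent2010, §3.1 eq. (3.2)] -/
theorem sum_bernCoeff {d : ℕ} (hd : 0 < d) (k : ℕ) :
    ∑ l ∈ Finset.range (k + 1), (bernCoeff d k l : 𝕜) = 1 := by
  classical
  -- evaluate `sum_pow_div_mul_bern` (one variable, `ι := Unit`) at `x = 1`
  have h := congrArg (eval fun _ : Unit => (1 : 𝕜)) (sum_pow_div_mul_bern (𝕜 := 𝕜) () hd k)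
  simp only [map_sum, map_mul, eval_C, map_pow, eval_X, one_pow, mul_one] at h
  rw [← h]
  have hb : ∀ m : Fin (d + 1), eval (fun _ : Unit => (1 : 𝕜)) (bern () d m : MvPolynomial Unit 𝕜) =
      if (m : ℕ) = d then 1 else 0 := by
    intro m
    rw [bern_eq]
    simp only [map_mul, eval_C, map_pow, eval_X, map_sub, map_one, sub_self, one_pow, mul_one]
    by_cases hm : (m : ℕ) = d
    · rw [if_pos hm, hm, Nat.sub_self, pow_zero, mul_one, Nat.choose_self, Nat.cast_one]
    · rw [if_neg hm, zero_pow (Nat.sub_ne_zero_of_lt (lt_of_le_of_ne (Nat.lt_succ_iff.1 m.isLt) hm)),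
        mul_zero]
  have hdne : (d : 𝕜) ≠ 0 := by exact_mod_cast hd.ne'
  simp only [hb, mul_ite, mul_one, mul_zero]
  rw [Finset.sum_eq_single (⟨d, Nat.lt_succ_self d⟩ : Fin (d + 1))]
  · rw [if_pos rfl, div_self hdne, one_pow]
  · intro m _ hm
    rw [if_neg fun h => hm (Fin.ext h)]
  · intro h
    exact absurd (Finset.mem_univ _) h

/-! ### §3 `B_d` of a multivariate monomial and the per-monomial defect -/

/-- The exponent `(γ, 0) ∈ ℕ^{ι ⊔ ι}` of the pure monomial `x^γ` as a Handelman product.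
[cite: DeklerkLaurent2010, §1.1 eq. (1.9)] -/
def inlExp (γ : ι → ℕ) : ι ⊕ ι →₀ ℕ :=
  Finsupp.equivFunOnFinite.symm (Sum.elim γ fun _ => 0)

omit [LinearOrder 𝕜] [IsStrictOrderedRing 𝕜] [DecidableEq ι] in
/-- `g^{(γ,0)} = x^γ`. [cite: DeklerkLaurent2010, §1.1 eq. (1.9)] -/
theorem cubeProd_inlExp (γ : ι → ℕ) : (cubeProd (inlExp γ) : MvPolynomial ι 𝕜) = ∏ i, X i ^ γ i := by
  unfold cubeProd inlExp
  simp

omit [DecidableEq ι] in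
/-- `|(γ,0)| = |γ|`. [cite: DeklerkLaurent2010, §1.1 eq. (1.9)] -/
theorem degree_inlExp (γ : ι → ℕ) : (inlExp γ).degree = ∑ i, γ i := by
  rw [Finsupp.degree_eq_sum, Fintype.sum_sum_type]
  simp [inlExp]

omit [LinearOrder 𝕜] [IsStrictOrderedRing 𝕜] [DecidableEq ι] in
/-- `x^α = g^{(α,0)}`. [cite: DeklerkLaurent2010, §1.1 eq. (1.9)] -/
theorem monomial_eq_cubeProd (α : ι →₀ ℕ) :
    (monomial α (1 : 𝕜) : MvPolynomial ι 𝕜) = cubeProd (inlExp ⇑α) := by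
  rw [cubeProd_inlExp, monomial_eq, map_one, one_mul, Finsupp.prod_fintype _ _ fun i => pow_zero _]

/-- The box `∏ᵢ {0,…,αᵢ}` of exponents `γ ≤ α`. [cite: DeklerkLaurent2010, §3.2 (the expansion of
`B_d(x^k) = ∏ B_d(xᵢ^{kᵢ})`)] -/
def box (α : ι →₀ ℕ) : Finset (ι → ℕ) := Fintype.piFinset fun i => Finset.range (α i + 1)

/-- `α ∈ box α`. [folklore] -/
private theorem self_mem_box (α : ι →₀ ℕ) : (⇑α : ι → ℕ) ∈ box α :=
  Fintype.mem_piFinset.2 fun i => Finset.self_mem_range_succ (α i)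

/-- Members of the box have degree `≤ |α|`. [folklore] -/
private theorem sum_le_of_mem_box {α : ι →₀ ℕ} {γ : ι → ℕ} (hγ : γ ∈ box α) :
    ∑ i, γ i ≤ α.degree := by
  rw [Finsupp.degree_eq_sum]
  exact Finset.sum_le_sum fun i _ => Nat.lt_succ_iff.1 (Finset.mem_range.1 (Fintype.mem_piFinset.1 hγ i))

/-- The coefficient `A_γ = ∏ᵢ a_{αᵢ,γᵢ}` of `x^γ` in `B_d(x^α) = ∏ᵢ B_d(xᵢ^{αᵢ})`.
[cite: DeklerkLaurent2010, §3.2 («B_d(x^k) = ∏ᵢ B_d(xᵢ^{kᵢ})»)] -/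
def boxCoeff (d : ℕ) (α : ι →₀ ℕ) (γ : ι → ℕ) : 𝕜 := ∏ i, bernCoeff d (α i) (γ i)

omit [DecidableEq ι] in
/-- `A_γ ≥ 0`. [cite: DeklerkLaurent2010, §3.1 Lemma 3.2 (ii)] -/
theorem boxCoeff_nonneg (d : ℕ) (α : ι →₀ ℕ) (γ : ι → ℕ) : 0 ≤ (boxCoeff d α γ : 𝕜) :=
  Finset.prod_nonneg fun _ _ => bernCoeff_nonneg _ _ _

/-- **`B_d(x^α)` in the monomial basis**: `B_d(x^α) = Σ_{γ ≤ α} A_γ x^γ`.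
[cite: DeklerkLaurent2010, §3.2 («B_d(x^k) = ∏ᵢ B_d(xᵢ^{kᵢ})»), §3.1] -/
theorem bernsteinOp_monomial {d : ℕ} (hd : 0 < d) (α : ι →₀ ℕ) :
    bernsteinOp d (monomial α (1 : 𝕜)) = ∑ γ ∈ box α, C (boxCoeff d α γ) * cubeProd (inlExp γ) := by
  rw [bernsteinOp_eq_prod_of_eval d (monomial α (1 : 𝕜)) (fun i t => t ^ α i) fun x => by
    rw [eval_monomial, one_mul, Finsupp.prod_fintype _ _ fun i => pow_zero _]]
  rw [Finset.prod_congr rfl fun i _ => sum_pow_div_mul_bern i hd (α i), box, Finset.prod_univ_sum]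
  refine Finset.sum_congr rfl fun γ _ => ?_
  rw [boxCoeff, cubeProd_inlExp, map_prod, ← Finset.prod_mul_distrib]

/-- `Σ_{γ ≤ α} A_γ = 1` (from (3.2) in each variable). [cite: DeklerkLaurent2010, §3.1 eq. (3.2)] -/
theorem sum_boxCoeff {d : ℕ} (hd : 0 < d) (α : ι →₀ ℕ) : ∑ γ ∈ box α, (boxCoeff d α γ : 𝕜) = 1 := by
  unfold box boxCoeff
  rw [← Finset.prod_univ_sum (fun i => Finset.range (α i + 1)) fun i l => (bernCoeff d (α i) l : 𝕜)]
  exact Finset.prod_eq_one fun i _ => sum_bernCoeff hd (α i)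

/-- **The per-monomial defect** `δ_α = 1 − A_α = 1 − ∏ᵢ d^{(αᵢ)}/d^{αᵢ}` (the weight of `x^α`
that `B_d` moves to lower monomials). [cite: DeklerkLaurent2010, §3.1 Lemma 3.2 (ii) (−a_k^{(k)}), §3.2 (3.5)] -/
def monomialDefect (d : ℕ) (α : ι →₀ ℕ) : 𝕜 := 1 - boxCoeff d α ⇑α

/-- `δ_α = Σ_{γ ≤ α, γ ≠ α} A_γ`. [cite: DeklerkLaurent2010, §3.1 Lemma 3.2 (ii) («Σᵢ₌₀^{k−1} aᵢ^{(k)} = −a_k^{(k)}»)] -/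
theorem monomialDefect_eq_sum {d : ℕ} (hd : 0 < d) (α : ι →₀ ℕ) :
    (monomialDefect d α : 𝕜) = ∑ γ ∈ (box α).erase ⇑α, boxCoeff d α γ := by
  have h := Finset.add_sum_erase (box α) (fun γ => (boxCoeff d α γ : 𝕜)) (self_mem_box α)
  rw [sum_boxCoeff hd] at h
  unfold monomialDefect
  linarith

/-- `δ_α ≥ 0`. [cite: DeklerkLaurent2010, §3.1 Lemma 3.2 (ii) («a_k^{(k)} ≤ 0»)] -/
theorem monomialDefect_nonneg {d : ℕ} (hd : 0 < d) (α : ι →₀ ℕ) : 0 ≤ (monomialDefect d α : 𝕜) := by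
  rw [monomialDefect_eq_sum hd]
  exact Finset.sum_nonneg fun γ _ => boxCoeff_nonneg _ _ _

omit [Fintype ι] [DecidableEq ι] in
/-- Lemma 3.2 (ii) in one variable: `1 − d^{(k)}/dᵏ ≤ C(k,2)/d` («`−(1/d) C(k,2) ≤ a_k^{(k)}`»).
[cite: DeklerkLaurent2010, §3.1 Lemma 3.2 (ii)] -/
theorem one_sub_bernCoeff_self_le {d : ℕ} (hd : 0 < d) (k : ℕ) :
    1 - (bernCoeff d k k : 𝕜) ≤ (k.choose 2 : 𝕜) / d := by
  rw [bernCoeff_self]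
  have hdpos : (0 : 𝕜) < d := by exact_mod_cast hd
  rcases Nat.lt_or_ge d k with hdk | hkd
  · -- `d < k`: the left side is `1`, and `C(k,2) ≥ k − 1 ≥ d`
    rw [Nat.descFactorial_eq_zero_iff_lt.2 hdk, Nat.cast_zero, zero_div, sub_zero, le_div_iff₀ hdpos,
      one_mul]
    have hk : d ≤ k.choose 2 := by
      obtain ⟨k', rfl⟩ : ∃ k', k = k' + 1 := ⟨k - 1, by omega⟩
      rw [Nat.choose_succ_succ, Nat.choose_one_right]
      omega
    exact_mod_cast hk
  · -- `k ≤ d`: the bound of `PolyaSimplexRate.one_sub_choose_div_le_polyaWeight`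
    have h := one_sub_choose_div_le_polyaWeight (𝕜 := 𝕜) (d - k) k
    rw [polyaWeight, Nat.sub_add_cancel hkd] at h
    linarith

omit [Fintype ι] [DecidableEq ι] in
/-- `∏ wᵢ ≥ 1 − Σ (1 − wᵢ)` for weights `wᵢ ∈ [0,1]`. [folklore] -/
private theorem one_sub_sum_le_prod {κ : Type*} (s : Finset κ) (w : κ → 𝕜) (h0 : ∀ i ∈ s, 0 ≤ w i)
    (h1 : ∀ i ∈ s, w i ≤ 1) : 1 - ∑ i ∈ s, (1 - w i) ≤ ∏ i ∈ s, w i := by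
  classical
  induction s using Finset.induction_on with
  | empty => simp
  | insert a s ha ih =>
    rw [Finset.sum_insert ha, Finset.prod_insert ha]
    have ih' := ih (fun i hi => h0 i (Finset.mem_insert_of_mem hi))
      (fun i hi => h1 i (Finset.mem_insert_of_mem hi))
    have hwa0 := h0 a (Finset.mem_insert_self a s)
    have hwa1 := h1 a (Finset.mem_insert_self a s)
    have hS : 0 ≤ ∑ i ∈ s, (1 - w i) :=
      Finset.sum_nonneg fun i hi => sub_nonneg.2 (h1 i (Finset.mem_insert_of_mem hi))
    have hP : 0 ≤ ∏ i ∈ s, w i := Finset.prod_nonneg fun i hi => h0 i (Finset.mem_insert_of_mem hi)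
    nlinarith

omit [DecidableEq ι] in
/-- **The defect bound** `δ_α ≤ (1/d) Σᵢ C(αᵢ,2)` (the per-monomial contribution in (3.5)–(3.6)).
[cite: DeklerkLaurent2010, §3.2 eq. (3.5)–(3.6) («|a_{kⱼ}^{(kⱼ)}|, Σ aᵢⱼ^{(kⱼ)} ≤ (1/d) C(kⱼ,2)»)] -/
theorem monomialDefect_le {d : ℕ} (hd : 0 < d) (α : ι →₀ ℕ) :
    (monomialDefect d α : 𝕜) ≤ (∑ i, ((α i).choose 2 : 𝕜)) / d := by
  rw [monomialDefect, boxCoeff, Finset.sum_div]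
  have h := one_sub_sum_le_prod (Finset.univ : Finset ι) (fun i => (bernCoeff d (α i) (α i) : 𝕜))
    (fun i _ => bernCoeff_nonneg _ _ _) fun i _ => by
      rw [bernCoeff_self]
      have hdk : (0 : 𝕜) < (d : 𝕜) ^ α i := pow_pos (by exact_mod_cast hd) _
      rw [div_le_one hdk, ← Nat.cast_pow, Nat.cast_le]
      exact Nat.descFactorial_le_pow _ _
  have h2 : ∑ i, (1 - (bernCoeff d (α i) (α i) : 𝕜)) ≤ ∑ i, ((α i).choose 2 : 𝕜) / d :=
    Finset.sum_le_sum fun i _ => one_sub_bernCoeff_self_le hd (α i)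
  linarith

/-! ### §4 The sign split (3.5): `p − B_d(p) + C(d,p) ∈ H_m(g)` -/

/-- **One monomial of (3.5).**  For every exponent `α` and scalar `c`,
`c (x^α − B_d(x^α)) + |c| δ_α ∈ H_{|α|}(g)`: with `c = c⁺ − c⁻`, it is
`c⁺δ'... = c⁺(1−A_α) x^α + c⁻(1−A_α)(1 − x^α) + Σ_{γ<α} (c⁺A_γ (1 − x^γ) + c⁻ A_γ x^γ)`, every
summand a nonnegative multiple of `x^γ ∈ H` or of `1 − x^γ ∈ H` (Lemma 3.1) — «we split the sum
depending on the signs of `p_k` and of `aᵢ^{(k)}` and we use Lemma 3.1».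
[cite: DeklerkLaurent2010, §3.1 (before Proposition 3.3), §3.2 eq. (3.5)] -/
theorem isHandelmanCube_smul_sub_bernsteinOp_monomial {d : ℕ} (hd : 0 < d) (α : ι →₀ ℕ) (c : 𝕜) :
    IsHandelmanCube α.degree
      (C c * (monomial α 1 - bernsteinOp d (monomial α (1 : 𝕜))) + C (|c| * monomialDefect d α)) := by
  set cp := max c 0 with hcp
  set cm := max (-c) 0 with hcm
  have hc : c = cp - cm := by
    rw [hcp, hcm]
    rcases le_total 0 c with h | h
    · rw [max_eq_left h, max_eq_right (neg_nonpos.2 h), sub_zero]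
    · rw [max_eq_right h, max_eq_left (neg_nonneg.2 h), zero_sub, neg_neg]
  have habs : |c| = cp + cm := by
    rw [hcp, hcm]
    rcases le_total 0 c with h | h
    · rw [abs_of_nonneg h, max_eq_left h, max_eq_right (neg_nonpos.2 h), add_zero]
    · rw [abs_of_nonpos h, max_eq_right h, max_eq_left (neg_nonneg.2 h), zero_add]
  have hcp0 : 0 ≤ cp := le_max_right _ _
  have hcm0 : 0 ≤ cm := le_max_right _ _
  set W : 𝕜 := boxCoeff d α ⇑α with hW
  set S : MvPolynomial ι 𝕜 := ∑ γ ∈ (box α).erase ⇑α, C (boxCoeff d α γ) * cubeProd (inlExp γ)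
    with hS
  have hB : bernsteinOp d (monomial α (1 : 𝕜)) = C W * cubeProd (inlExp ⇑α) + S := by
    rw [bernsteinOp_monomial hd, ← Finset.add_sum_erase (box α)
      (fun γ => C (boxCoeff d α γ) * cubeProd (inlExp γ)) (self_mem_box α)]
  have hδ : (monomialDefect d α : 𝕜) = 1 - W := rfl
  have hδ' : C (∑ γ ∈ (box α).erase ⇑α, (boxCoeff d α γ : 𝕜)) = (C (1 - W) : MvPolynomial ι 𝕜) := by
    rw [← monomialDefect_eq_sum hd, hδ]
  -- the rearranged form
  have key : C c * (monomial α 1 - bernsteinOp d (monomial α (1 : 𝕜))) + C (|c| * monomialDefect d α) =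
      C (cp * (1 - W)) * cubeProd (inlExp ⇑α) + C (cm * (1 - W)) * (1 - cubeProd (inlExp ⇑α)) +
        ∑ γ ∈ (box α).erase ⇑α, (C (cp * boxCoeff d α γ) * (1 - cubeProd (inlExp γ)) +
          C (cm * boxCoeff d α γ) * cubeProd (inlExp γ)) := by
    have hsum : ∑ γ ∈ (box α).erase ⇑α, (C (cp * boxCoeff d α γ) * (1 - cubeProd (inlExp γ)) +
        C (cm * boxCoeff d α γ) * cubeProd (inlExp γ) : MvPolynomial ι 𝕜) =
        C cp * C (1 - W) - C cp * S + C cm * S := by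
      rw [← hδ', ← map_mul, Finset.mul_sum, hS, Finset.mul_sum, Finset.mul_sum, map_sum,
        ← Finset.sum_sub_distrib, ← Finset.sum_add_distrib]
      refine Finset.sum_congr rfl fun γ _ => ?_
      simp only [map_mul]
      ring
    rw [hsum, hB, monomial_eq_cubeProd, habs, hδ, hc]
    simp only [map_sub, map_add, map_mul, map_one]
    ring
  rw [key]
  have h1W : 0 ≤ 1 - W := hδ ▸ monomialDefect_nonneg hd α
  have hdegα : (inlExp ⇑α).degree = α.degree := by rw [degree_inlExp, Finsupp.degree_eq_sum]
  refine IsHandelmanCube.add (IsHandelmanCube.add ?_ ?_) (IsHandelmanCube.sum _ fun γ hγ => ?_)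
  · exact hdegα ▸ (isHandelmanCube_cubeProd (inlExp ⇑α)).smul (mul_nonneg hcp0 h1W)
  · exact hdegα ▸ (isHandelmanCube_one_sub_cubeProd (inlExp ⇑α)).smul (mul_nonneg hcm0 h1W)
  · have hγle : (inlExp γ).degree ≤ α.degree := by
      rw [degree_inlExp]; exact sum_le_of_mem_box (Finset.mem_of_mem_erase hγ)
    exact (((isHandelmanCube_one_sub_cubeProd (inlExp γ)).mono hγle).smul
      (mul_nonneg hcp0 (boxCoeff_nonneg d α γ))).add
      (((isHandelmanCube_cubeProd (inlExp γ)).mono hγle).smul (mul_nonneg hcm0 (boxCoeff_nonneg d α γ)))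

/-- **The constant `C(d,p)`** of (3.1)/(3.5), in closed form: `C(d,p) = Σ_α |p_α| δ_α`.
[cite: DeklerkLaurent2010, §3 eq. (3.1), §3.2 eq. (3.5)] -/
def dklConstant (d : ℕ) (p : MvPolynomial ι 𝕜) : 𝕜 :=
  ∑ α ∈ p.support, |coeff α p| * monomialDefect d α

/-- `C(d,p) ≥ 0`. [cite: DeklerkLaurent2010, §3.2 eq. (3.5)] -/
theorem dklConstant_nonneg {d : ℕ} (hd : 0 < d) (p : MvPolynomial ι 𝕜) : 0 ≤ dklConstant d p :=
  Finset.sum_nonneg fun α _ => mul_nonneg (abs_nonneg _) (monomialDefect_nonneg hd α)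

omit [DecidableEq ι] in
/-- **(3.5)–(3.6), first inequality**: `C(d,p) ≤ (1/d) Σ_α |p_α| Σᵢ C(αᵢ,2)`.
[cite: DeklerkLaurent2010, §3.2 eq. (3.5)–(3.6)] -/
theorem dklConstant_le {d : ℕ} (hd : 0 < d) (p : MvPolynomial ι 𝕜) :
    dklConstant d p ≤ (∑ α ∈ p.support, |coeff α p| * ∑ i, ((α i).choose 2 : 𝕜)) / d := by
  rw [dklConstant, Finset.sum_div]
  refine Finset.sum_le_sum fun α _ => ?_
  rw [mul_div_assoc]
  exact mul_le_mul_of_nonneg_left (monomialDefect_le hd α) (abs_nonneg _)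

/-- **`p − B_d(p) + C(d,p) ∈ H_m(g)`** for `m ≥ deg p` — the decomposition «`p − B_d(p) = q − C(d,p)`
… where `q ∈ H_m(g)`» of (3.5). [cite: DeklerkLaurent2010, §3.2 eq. (3.5)] -/
theorem isHandelmanCube_sub_bernsteinOp {d : ℕ} (hd : 0 < d) (p : MvPolynomial ι 𝕜) {m : ℕ}
    (hm : p.totalDegree ≤ m) :
    IsHandelmanCube m (p - bernsteinOp d p + C (dklConstant d p)) := by
  have hp : ∑ α ∈ p.support, C (coeff α p) * monomial α (1 : 𝕜) = p := by
    conv_rhs => rw [p.as_sum]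
    exact Finset.sum_congr rfl fun α _ => by rw [C_mul_monomial, mul_one]
  have hpB : ∑ α ∈ p.support, C (coeff α p) * bernsteinOp d (monomial α (1 : 𝕜)) =
      bernsteinOp d p := by
    rw [← Finset.sum_congr rfl fun α _ => bernsteinOp_C_mul d (coeff α p) (monomial α (1 : 𝕜)),
      ← bernsteinOp_sum, hp]
  have e : ∑ α ∈ p.support, (C (coeff α p) * (monomial α 1 - bernsteinOp d (monomial α (1 : 𝕜))) +
        C (|coeff α p| * monomialDefect d α)) = p - bernsteinOp d p + C (dklConstant d p) := by
    rw [Finset.sum_add_distrib, Finset.sum_congr rfl fun α _ =>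
      mul_sub (C (coeff α p)) (monomial α (1 : 𝕜)) (bernsteinOp d (monomial α 1)),
      Finset.sum_sub_distrib, hp, hpB, dklConstant, map_sum]
  rw [← e]
  refine IsHandelmanCube.sum _ fun α hα => (isHandelmanCube_smul_sub_bernsteinOp_monomial hd α _).mono ?_
  have h := le_totalDegree hα
  rw [Finsupp.degree_apply]
  exact h.trans hm

/-! ### §5 Theorem 3.4 -/

/-- **Theorem 3.4 (i) (explicit constant).**  For every integer `d ≥ 1`, every `μ` with
`μ ≤ p` on the grid `Q(d) = {0, 1/d, …, 1}ⁿ`, every `m ≥ deg p` and every `c ≥ C(d,p)`: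
`p − μ + c ∈ H_{max(dn, m)}(g)` — from (3.1): `p − μ + c = B_d(p − μ) + (p − B_d(p) + C(d,p)) + (c − C(d,p))`
with `B_d(p − μ) ∈ H_{dn}(g)`.  The printed (i) is the case `μ = p_min,Q`, `c = (L(p)/d) C(m+1,3) nᵐ`.
[cite: DeklerkLaurent2010, §3 eq. (3.1), Theorem 3.4 (i)] -/
theorem isHandelmanCube_sub_C_add_C {d : ℕ} (hd : 0 < d) {p : MvPolynomial ι 𝕜} {μ : 𝕜}
    (hμ : ∀ k : ι → Fin (d + 1), μ ≤ eval (gridPt 𝕜 d k) p) {m : ℕ} (hm : p.totalDegree ≤ m) {c : 𝕜}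
    (hc : dklConstant d p ≤ c) :
    IsHandelmanCube (max (d * Fintype.card ι) m) (p - C μ + C c) := by
  have e : p - C μ + C c =
      bernsteinOp d (p - C μ) + (p - bernsteinOp d p + C (dklConstant d p)) + C (c - dklConstant d p) := by
    rw [bernsteinOp_sub, bernsteinOp_C, map_sub]
    ring
  rw [e]
  refine IsHandelmanCube.add (IsHandelmanCube.add ?_ ?_) (isHandelmanCube_C (sub_nonneg.2 hc))
  · refine (isHandelmanCube_bernsteinOp fun k => ?_).mono (le_max_left _ _)
    rw [map_sub, eval_C]
    exact sub_nonneg.2 (hμ k)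
  · exact (isHandelmanCube_sub_bernsteinOp hd p hm).mono (le_max_right _ _)

/-- **Theorem 3.4 (ii) (explicit constant).**  If `μ ≤ p` on the grid `Q(d)` and `C(d,p) ≤ μ`, then
`p ∈ H_{max(dn, m)}(g)` («If `p` is positive on `Q` and `d ≥ …`, then `p_min,Q − C(d,p) ≥ 0` and
thus (3.4) is a decomposition of Handelman type»).
[cite: DeklerkLaurent2010, §3 Proposition 3.3, Theorem 3.4 (ii)] -/
theorem isHandelmanCube_of_dklConstant_le {d : ℕ} (hd : 0 < d) {p : MvPolynomial ι 𝕜} {μ : 𝕜}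
    (hμ : ∀ k : ι → Fin (d + 1), μ ≤ eval (gridPt 𝕜 d k) p) {m : ℕ} (hm : p.totalDegree ≤ m)
    (hc : dklConstant d p ≤ μ) : IsHandelmanCube (max (d * Fintype.card ι) m) p := by
  have h := isHandelmanCube_sub_C_add_C hd hμ hm hc
  rwa [sub_add_cancel] at h

/-- **Theorem 3.4 (ii), usable form.**  If `0 < μ ≤ p` on the grid `Q(d)` and
`Σ_α |p_α| Σᵢ C(αᵢ,2) ≤ d μ`, then `p ∈ H_{max(dn, m)}(g)` for every `m ≥ deg p` — an explicit LP
degree at which the Handelman hierarchy certifies positivity of `p` on `[0,1]ⁿ`.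
[cite: DeklerkLaurent2010, Theorem 3.4 (ii), Theorem 1.4 (i)] -/
theorem isHandelmanCube_of_le {d : ℕ} (hd : 0 < d) {p : MvPolynomial ι 𝕜} {μ : 𝕜}
    (hμ : ∀ k : ι → Fin (d + 1), μ ≤ eval (gridPt 𝕜 d k) p) {m : ℕ} (hm : p.totalDegree ≤ m)
    (h : ∑ α ∈ p.support, |coeff α p| * ∑ i, ((α i).choose 2 : 𝕜) ≤ d * μ) :
    IsHandelmanCube (max (d * Fintype.card ι) m) p := by
  refine isHandelmanCube_of_dklConstant_le hd hμ hm ((dklConstant_le hd p).trans ?_)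
  have hdpos : (0 : 𝕜) < d := by exact_mod_cast hd
  rwa [div_le_iff₀ hdpos, mul_comm]

/-- **Grid error bound for every degree** (the analogue of Theorem 1.4 (iii) with the explicit
constant): `p ≥ p_min,Q(d) − C(d,p)` on `Q`, i.e. `p_min,Q(d) − p_min,Q ≤ C(d,p) ≤ (1/d) Σ_α |p_α| Σᵢ C(αᵢ,2)`.
[cite: DeklerkLaurent2010, Theorem 1.4 (iii), §3 eq. (3.1)] -/
theorem le_eval_of_grid {d : ℕ} (hd : 0 < d) {p : MvPolynomial ι 𝕜} {μ : 𝕜}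
    (hμ : ∀ k : ι → Fin (d + 1), μ ≤ eval (gridPt 𝕜 d k) p) {x : ι → 𝕜} (hx0 : ∀ i, 0 ≤ x i)
    (hx1 : ∀ i, x i ≤ 1) : μ - dklConstant d p ≤ eval x p := by
  refine le_eval_of_isHandelmanCube_sub_C (r := max (d * Fintype.card ι) p.totalDegree) ?_ hx0 hx1
  have h := isHandelmanCube_sub_C_add_C hd hμ le_rfl (le_refl (dklConstant d p))
  rwa [map_sub, ← sub_add] 

/-! ### §6 The printed constant: `C(d,p) ≤ (L(p)/d) C(m+1,3) nᵐ` ((3.6)) and Theorem 3.4 as printed -/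

omit [Fintype ι] [DecidableEq ι] in
/-- `C(a+b,2) = C(a,2) + ab + C(b,2)`. [folklore] -/
private theorem choose_two_add (a b : ℕ) : (a + b).choose 2 = a.choose 2 + a * b + b.choose 2 := by
  induction b with
  | zero => simp
  | succ b ih =>
    rw [← Nat.add_assoc, Nat.choose_succ_succ', ih, Nat.choose_one_right, Nat.choose_succ_succ' b 1,
      Nat.choose_one_right]
    ring

omit [Fintype ι] [DecidableEq ι] in
/-- `Σⱼ C(kⱼ,2) ≤ C(|k|,2)` («using the fact that `Σⱼ₌₁ⁿ C(kⱼ,2) ≤ C(|k|,2)`»).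
[cite: DeklerkLaurent2010, §3.2 (before (3.6))] -/
theorem sum_choose_two_le {κ : Type*} (s : Finset κ) (f : κ → ℕ) :
    ∑ i ∈ s, (f i).choose 2 ≤ (∑ i ∈ s, f i).choose 2 := by
  classical
  induction s using Finset.induction_on with
  | empty => simp
  | insert a s ha ih =>
    rw [Finset.sum_insert ha, Finset.sum_insert ha, choose_two_add]
    omega

omit [Fintype ι] [DecidableEq ι] in
/-- `Σ_{l=0}^m C(l,2) = C(m+1,3)` («`Σ_{l=0}^m C(l,2) = C(m+1,3)`»). [cite: DeklerkLaurent2010, §3.2 eq. (3.6)] -/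
theorem sum_range_choose_two (m : ℕ) : ∑ l ∈ Finset.range (m + 1), l.choose 2 = (m + 1).choose 3 := by
  induction m with
  | zero => simp [Nat.choose]
  | succ m ih => rw [Finset.sum_range_succ, ih, Nat.choose_succ_succ' (m + 1) 2, add_comm]

omit [LinearOrder 𝕜] [IsStrictOrderedRing 𝕜] [DecidableEq ι] in
/-- `(Σᵢ xᵢ)ˡ` evaluated at `x = (1,…,1)` is `nˡ`. [folklore] -/
private theorem eval_one_sum_X_pow (l : ℕ) :
    eval (fun _ => (1 : 𝕜)) ((∑ i, X i : MvPolynomial ι 𝕜) ^ l) = (Fintype.card ι : 𝕜) ^ l := by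
  rw [map_pow, map_sum]
  simp

omit [DecidableEq ι] in
/-- **`Σ_{|k| = l} |k|!/k! = nˡ`, as an inequality over any set of exponents of degree `l`**
(«and `Σ_{k ∈ ℕⁿ, |k| = l} |k|!/k! = nˡ`»). [cite: DeklerkLaurent2010, §3.2 (before (3.6))] -/
theorem sum_multinomial_le_pow (s : Finset (ι →₀ ℕ)) {l : ℕ} (hs : ∀ α ∈ s, α.degree = l) :
    ∑ α ∈ s, (α.multinomial : 𝕜) ≤ (Fintype.card ι : 𝕜) ^ l := by
  set S := (∑ i, X i : MvPolynomial ι 𝕜) ^ l with hS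
  have hcoeff : ∀ α : ι →₀ ℕ, α.degree = l → coeff α S = (α.multinomial : 𝕜) := by
    intro α hα
    rw [hS, coeff_sum_X_pow_of_fintype, if_pos]
    rw [Finsupp.degree_apply] at hα
    simpa [Finsupp.sum] using hα
  have hsub : s ⊆ S.support := by
    intro α hα
    rw [mem_support_iff, hcoeff α (hs α hα), Finsupp.multinomial_eq]
    exact_mod_cast (Nat.multinomial_pos _ _).ne'
  have heval : eval (fun _ => (1 : 𝕜)) S = ∑ α ∈ S.support, coeff α S := by
    rw [eval_eq]
    exact Finset.sum_congr rfl fun α _ => by simp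
  have hdeg : ∀ α ∈ S.support, α.degree = l := by
    intro α hα
    have h := mem_support_iff.1 hα
    rw [hS, coeff_sum_X_pow_of_fintype] at h
    split_ifs at h with hl
    · rw [Finsupp.degree_apply]
      simpa [Finsupp.sum] using hl
    · exact (h (by simp)).elim
  calc ∑ α ∈ s, (α.multinomial : 𝕜) ≤ ∑ α ∈ S.support, (α.multinomial : 𝕜) :=
        Finset.sum_le_sum_of_subset_of_nonneg hsub fun α _ _ => Nat.cast_nonneg _
    _ = ∑ α ∈ S.support, coeff α S := Finset.sum_congr rfl fun α hα => (hcoeff α (hdeg α hα)).symm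
    _ = (Fintype.card ι : 𝕜) ^ l := by rw [← heval, hS, eval_one_sum_X_pow]

omit [DecidableEq ι] in
/-- **(3.6)**: if `|p_k| ≤ L |k|!/k!` for all `k` (i.e. `L ≥ L(p)` of (1.3)) and `deg p ≤ m`, then
`Σ_k |p_k| Σⱼ C(kⱼ,2) ≤ L C(m+1,3) nᵐ`, hence `C(d,p) ≤ (L/d) C(m+1,3) nᵐ`.
[cite: DeklerkLaurent2010, §1 eq. (1.3), §3.2 eq. (3.6)] -/
theorem sum_abs_coeff_mul_le [Nonempty ι] {p : MvPolynomial ι 𝕜} {L : 𝕜}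
    (hL : ∀ α, |coeff α p| ≤ L * (α.multinomial : 𝕜)) {m : ℕ} (hm : p.totalDegree ≤ m) :
    ∑ α ∈ p.support, |coeff α p| * ∑ i, ((α i).choose 2 : 𝕜) ≤
      L * ((m + 1).choose 3 : 𝕜) * (Fintype.card ι : 𝕜) ^ m := by
  have hL0 : 0 ≤ L := by
    have h := hL 0
    rw [show (0 : ι →₀ ℕ).multinomial = 1 by simp [Finsupp.multinomial_eq], Nat.cast_one, mul_one] at h
    exact (abs_nonneg _).trans h
  have hn : (1 : 𝕜) ≤ Fintype.card ι := by exact_mod_cast Fintype.card_pos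
  have hdegle : ∀ α ∈ p.support, α.degree ∈ Finset.range (m + 1) := by
    intro α hα
    rw [Finset.mem_range, Nat.lt_succ_iff, Finsupp.degree_apply]
    exact (le_totalDegree hα).trans hm
  -- Step 1: `|p_α| Σᵢ C(αᵢ,2) ≤ L · multinomial(α) · C(|α|,2)`
  have h1 : ∀ α ∈ p.support, |coeff α p| * ∑ i, ((α i).choose 2 : 𝕜) ≤
      L * ((α.multinomial : 𝕜) * ((α.degree).choose 2 : 𝕜)) := by
    intro α _
    rw [← mul_assoc]
    refine mul_le_mul (hL α) ?_ (Finset.sum_nonneg fun i _ => Nat.cast_nonneg _)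
      (mul_nonneg hL0 (Nat.cast_nonneg _))
    rw [← Nat.cast_sum, Nat.cast_le, Finsupp.degree_eq_sum]
    exact sum_choose_two_le _ _
  -- Step 2: group by degree and use `Σ_{|α| = l} multinomial ≤ nˡ ≤ nᵐ`
  have h2 : ∑ α ∈ p.support, (α.multinomial : 𝕜) * ((α.degree).choose 2 : 𝕜) ≤
      ((m + 1).choose 3 : 𝕜) * (Fintype.card ι : 𝕜) ^ m := by
    rw [← Finset.sum_fiberwise_of_maps_to hdegle]
    calc ∑ l ∈ Finset.range (m + 1), ∑ α ∈ p.support with α.degree = l,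
          (α.multinomial : 𝕜) * ((α.degree).choose 2 : 𝕜)
        = ∑ l ∈ Finset.range (m + 1), (l.choose 2 : 𝕜) *
            ∑ α ∈ p.support with α.degree = l, (α.multinomial : 𝕜) := by
          refine Finset.sum_congr rfl fun l _ => ?_
          rw [Finset.mul_sum]
          refine Finset.sum_congr rfl fun α hα => ?_
          rw [(Finset.mem_filter.1 hα).2, mul_comm]
      _ ≤ ∑ l ∈ Finset.range (m + 1), (l.choose 2 : 𝕜) * (Fintype.card ι : 𝕜) ^ m := by
          refine Finset.sum_le_sum fun l hl => mul_le_mul_of_nonneg_left ?_ (Nat.cast_nonneg _)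
          refine (sum_multinomial_le_pow _ fun α hα => (Finset.mem_filter.1 hα).2).trans ?_
          exact pow_le_pow_right₀ hn (Nat.lt_succ_iff.1 (Finset.mem_range.1 hl))
      _ = ((m + 1).choose 3 : 𝕜) * (Fintype.card ι : 𝕜) ^ m := by
          rw [← Finset.sum_mul, ← Nat.cast_sum, sum_range_choose_two]
  calc ∑ α ∈ p.support, |coeff α p| * ∑ i, ((α i).choose 2 : 𝕜)
      ≤ ∑ α ∈ p.support, L * ((α.multinomial : 𝕜) * ((α.degree).choose 2 : 𝕜)) :=
        Finset.sum_le_sum h1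
    _ = L * ∑ α ∈ p.support, (α.multinomial : 𝕜) * ((α.degree).choose 2 : 𝕜) := by
        rw [Finset.mul_sum]
    _ ≤ L * (((m + 1).choose 3 : 𝕜) * (Fintype.card ι : 𝕜) ^ m) :=
        mul_le_mul_of_nonneg_left h2 hL0
    _ = _ := by ring

omit [DecidableEq ι] in
/-- **(3.6) for `C(d,p)`**: `C(d,p) ≤ (L/d) C(m+1,3) nᵐ`. [cite: DeklerkLaurent2010, §3.2 eq. (3.6)] -/
theorem dklConstant_le_printed [Nonempty ι] {d : ℕ} (hd : 0 < d) {p : MvPolynomial ι 𝕜} {L : 𝕜}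
    (hL : ∀ α, |coeff α p| ≤ L * (α.multinomial : 𝕜)) {m : ℕ} (hm : p.totalDegree ≤ m) :
    dklConstant d p ≤ L / d * ((m + 1).choose 3 : 𝕜) * (Fintype.card ι : 𝕜) ^ m := by
  have hdpos : (0 : 𝕜) < d := by exact_mod_cast hd
  refine (dklConstant_le hd p).trans ?_
  rw [div_le_iff₀ hdpos]
  refine (sum_abs_coeff_mul_le hL hm).trans (le_of_eq ?_)
  field_simp

/-- **Theorem 3.4 (i), as printed.**  «For any integer `d ≥ 1`,
`p − p_min,Q + (L(p)/d) C(m+1,3) nᵐ ∈ H_r(g)` for some integer `r ≤ max(dn, m)`» — here for any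
`μ ≤ p` on the grid `Q(d)` (in particular `μ = p_min,Q`) and any `L ≥ L(p)`.
[cite: DeklerkLaurent2010, Theorem 3.4 (i), Theorem 1.4 (ii)] -/
theorem isHandelmanCube_sub_C_add_C_printed [Nonempty ι] {d : ℕ} (hd : 0 < d)
    {p : MvPolynomial ι 𝕜} {μ : 𝕜} (hμ : ∀ k : ι → Fin (d + 1), μ ≤ eval (gridPt 𝕜 d k) p)
    {L : 𝕜} (hL : ∀ α, |coeff α p| ≤ L * (α.multinomial : 𝕜)) {m : ℕ} (hm : p.totalDegree ≤ m) :
    IsHandelmanCube (max (d * Fintype.card ι) m)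
      (p - C μ + C (L / d * ((m + 1).choose 3 : 𝕜) * (Fintype.card ι : 𝕜) ^ m)) :=
  isHandelmanCube_sub_C_add_C hd hμ hm (dklConstant_le_printed hd hL hm)

/-- **Theorem 3.4 (ii) / Theorem 1.4 (i), as printed.**  «If `p` is positive on `Q`, then
`p ∈ H_r(g)` for some integer `r ≤ n⌈(L(p)/p_min,Q) C(m+1,3) nᵐ⌉`»: for `0 < μ ≤ p` on the grid
`Q(d)`, `L ≥ L(p)` and `d ≥ (L/μ) C(m+1,3) nᵐ`, `p ∈ H_{max(dn,m)}(g)` (degree `max(dn, m)` as in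
(i); see the module docstring).
[cite: DeklerkLaurent2010, Theorem 3.4 (ii), Theorem 1.4 (i)] -/
theorem isHandelmanCube_of_printed [Nonempty ι] {d : ℕ} (hd : 0 < d) {p : MvPolynomial ι 𝕜}
    {μ : 𝕜} (hμpos : 0 < μ) (hμ : ∀ k : ι → Fin (d + 1), μ ≤ eval (gridPt 𝕜 d k) p) {L : 𝕜}
    (hL : ∀ α, |coeff α p| ≤ L * (α.multinomial : 𝕜)) {m : ℕ} (hm : p.totalDegree ≤ m)
    (hdL : L / μ * ((m + 1).choose 3 : 𝕜) * (Fintype.card ι : 𝕜) ^ m ≤ d) :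
    IsHandelmanCube (max (d * Fintype.card ι) m) p := by
  refine isHandelmanCube_of_dklConstant_le hd hμ hm ((dklConstant_le_printed hd hL hm).trans ?_)
  have hdpos : (0 : 𝕜) < d := by exact_mod_cast hd
  rw [div_mul_eq_mul_div, div_mul_eq_mul_div, div_le_iff₀ hμpos] at hdL
  rw [div_mul_eq_mul_div, div_mul_eq_mul_div, div_le_iff₀ hdpos]
  linarith

end Literature.Algebra.Polynomial.HandelmanHypercubeDegree

end
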